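import Literature.NumberTheory.Transcendental.HermiteIntegerPointsRatio
import Literature.NumberTheory.Transcendental.CijsouwWaldschmidt1977Setup
import Mathlib.Analysis.SpecialFunctions.ExpDeriv
import Mathlib.Analysis.Calculus.IteratedDeriv.Lemmas
import Mathlib.Analysis.Complex.CauchyIntegral
import HarnessLib

/-!
# Cell abc-stewartyu, rung A1.L, WP-L.A parcel P-A5: the ARCHIMEDEAN k-step, analytic core (setup-free)

`Summits/ABC/StewartYu/ArchG3KStepCore.lean` — cell `abc-stewartyu` (HOME `run/shared/lean/pub/abc-stewartyu/`; TRANCHE PLAN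
v1.2 §4′ row P-A5; design memo HOME/p1/memo/ArchG3-START-design-g9.md «design B»; seat lp-1).  Theorems only; no definition,
no named fact.  This is the archimedean twin of the analytic half of the cell's `p`-adic k-step
(`G3Setup.norm_iteratedDeriv_g3F_le_of_forall`, `G3Setup.norm_g3F_le_of_zerosΦ` in `PadicG3FunctionsB` / `PadicG3KStepPhi`),
written SETUP-FREE so that it does not wait on, nor collide with, the archimedean construction layer (parcel P-A4):

the objects are an arbitrary family `F : Tau n → ℂ → ℂ` of ENTIRE functions indexed by Nesterenko's multi-orders
`τ = (τ₀, τ') ∈ ℕ × ℕⁿ` which is CLOSED UNDER `d/dz` in the shape of Nesterenko 2003 (4.20) / the cell's `hasDerivAt_g3F`,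
`deriv (F τ) = Σ_{i : Fin (n+1)} c τ i · F (τ + eᵢ)` with `Σᵢ ‖c τ i‖ ≤ Cs` (`Cs ≥ 1`; archimedean: the coefficients
`τ₀ + 1` and `log αₖ` are NOT of norm `≤ 1`, so each derivative costs a factor `Cs`), together with a TWIST `γ ∈ ℂ`
(design B: the slab class is not centred, and one extrapolates `e^{γz} F_τ(z)`, whose frequencies are small).

* `norm_iteratedDeriv_le_of_forall` — JETS FROM VALUES: `‖F τ' (a)‖ ≤ ε` for `|τ'| ≤ M` ⇒ `‖(F τ)^{(k)}(a)‖ ≤ Csᵏ ε` for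
  `|τ| + k ≤ M` (twin of `norm_iteratedDeriv_g3F_le_of_forall`; Cijsouw–Waldschmidt (11)).
* `norm_iteratedDeriv_twist_le` — the twisted jets `‖(e^{γz} F τ)^{(σ)}(x)‖ ≤ ((1+‖γ‖)Cs)ᵗ e^{‖γ‖‖x‖} ε` (Leibniz).
* `norm_twist_le_of_small_values_symm` — **the extrapolation at the symmetric nodes** `x ∈ ℤ, |x| ≤ N` (Nesterenko's
  `𝒳_{0,0}`, `𝒳_{s,ν}` with `ν ≥ 1`): approximate zeros `‖F τ'' x‖ ≤ ε` at the nodes for `|τ''| < Tlo` and the growth bound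
  `‖e^{γz} F τ z‖ ≤ B_G` on the disc `‖z‖ ≤ (3E+1)(2N+1) + N` give, for `|τ| + t ≤ Tlo` and `‖w‖ ≤ 3N+2`,
  `‖e^{γw} F τ w‖ ≤ 2(2N+1)^{t+1} t (20e)^{(2N+1)t} · ((1+‖γ‖)Cs)ᵗ e^{‖γ‖N} ε + B_G · E^{−(2N+1)t}` — each of the
  `(2N+1)t` zeros gains the FREE factor `1/E = e^{−G}` (tree: `CW77.hermite_symm_integer_points_ratio`).
* `norm_twist_le_of_small_values_odd` — the same at the odd nodes `x ≡ 1 (2)`, `|x| ≤ 2m − 1` (Nesterenko's `𝒳_{s,0}`),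
  for `‖w‖ ≤ 6m`, big disc `‖z‖ ≤ (12E+6)m` (tree: `CW77.hermite_odd_points_ratio`).
* `norm_le_of_small_values_symm` / `_odd` — the untwisted values `‖F τ w‖ ≤ e^{‖γ‖‖w‖} · (…)`.

WHAT THIS IS NOT: not the Liouville conclusion at the new integer points (`ArchG3KStep.lean`), not the construction of the
archimedean family, its sizes `B_G`, `ε` (`= Q·|Λ/b_{j₀}|·…`) or the bookkeeping of `E = e^G` (parcels P-A4/P-A8); no crux moves.

## References
* Yu. V. Nesterenko, *Linear forms in logarithms of rational numbers*, LNM 1819 (2003) — §4.1 (4.8)–(4.11), Lemma 4.2; §4.2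
  (4.16)–(4.20) (the differential equations), Lemma 4.3, (4.24)–(4.30) (the sets `𝒳_{s,ν}`, radius doubling). [Nesterenko2003]
* P. L. Cijsouw, M. Waldschmidt, Compositio Math. 34 (1977) — §4 (11) (jets from values), Lemma 2. [CijsouwWaldschmidt1977]
* M. Waldschmidt, Acta Arith. 37 (1980) — Lemma 3.5 (the tree's `w80_norm_Φ_le_of_odd_zeros`, the model of the proofs). [Waldschmidt1980]
-/

noncomputable section

open Finset Real
open Literature.NumberTheory.Transcendental
open Literature.NumberTheory.Transcendental.CW77 (hermite_symm_integer_points_ratio hermite_odd_points_ratio)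
open Literature.NumberTheory.Transcendental.CW77.Setup (Tau tauNorm bumpτ tauNorm_bumpτ)

namespace Summit.ABC.StewartYu

namespace ArchKStep

variable {n : ℕ}

/-! ### Jets from values for a family of entire functions closed under `d/dz` -/

/-- **The iterated derivatives of a family closed under `d/dz`**: if `deriv (F τ) = Σᵢ c τ i · F (τ+eᵢ)` then
`(F τ)^{(k+1)}(a) = Σᵢ c τ i · (F (τ+eᵢ))^{(k)}(a)`. [cite: Nesterenko2003, §4.2 (4.20)] [cite: CijsouwWaldschmidt1977, §4 (11)] -/
theorem iteratedDeriv_succ_of_ode (F : Tau n → ℂ → ℂ) (c : Tau n → Fin (n + 1) → ℂ)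
    (hdiff : ∀ τ, Differentiable ℂ (F τ)) (hode : ∀ τ z, deriv (F τ) z = ∑ i, c τ i * F (bumpτ τ i) z)
    (τ : Tau n) (k : ℕ) (a : ℂ) :
    iteratedDeriv (k + 1) (F τ) a = ∑ i, c τ i * iteratedDeriv k (F (bumpτ τ i)) a := by
  have hd : deriv (F τ) = fun z => ∑ i, c τ i * F (bumpτ τ i) z := funext (hode τ)
  rw [iteratedDeriv_succ', hd,
    iteratedDeriv_fun_sum fun i _ => contDiffAt_const.mul ((hdiff (bumpτ τ i)).contDiff.contDiffAt)]
  refine sum_congr rfl fun i _ => ?_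
  exact iteratedDeriv_const_mul _ ((hdiff (bumpτ τ i)).contDiff.contDiffAt)

/-- **Jets from values** (archimedean: each derivative costs the factor `Cs ≥ Σᵢ ‖c τ i‖`, `Cs ≥ 1`): if `‖F τ' (a)‖ ≤ ε`
whenever `|τ'| ≤ M`, then `‖(F τ)^{(k)}(a)‖ ≤ Csᵏ · ε` whenever `|τ| + k ≤ M`.
[cite: CijsouwWaldschmidt1977, §4 (11) (p. 189)] [cite: Nesterenko2003, §4.2 (4.20)–(4.21)] -/
theorem norm_iteratedDeriv_le_of_forall (F : Tau n → ℂ → ℂ) (c : Tau n → Fin (n + 1) → ℂ)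
    (hdiff : ∀ τ, Differentiable ℂ (F τ)) (hode : ∀ τ z, deriv (F τ) z = ∑ i, c τ i * F (bumpτ τ i) z)
    {M : ℕ} {Cs : ℝ} (hCs1 : 1 ≤ Cs) (hc : ∀ τ, tauNorm τ < M → ∑ i, ‖c τ i‖ ≤ Cs)
    (a : ℂ) {ε : ℝ} (hε0 : 0 ≤ ε) (hε : ∀ τ : Tau n, tauNorm τ ≤ M → ‖F τ a‖ ≤ ε) :
    ∀ (k : ℕ) (τ : Tau n), tauNorm τ + k ≤ M → ‖iteratedDeriv k (F τ) a‖ ≤ Cs ^ k * ε := by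
  intro k
  induction k with
  | zero => intro τ hτ; simpa using hε τ (by simpa using hτ)
  | succ k ih =>
    intro τ hτ
    rw [iteratedDeriv_succ_of_ode F c hdiff hode τ k a]
    calc ‖∑ i, c τ i * iteratedDeriv k (F (bumpτ τ i)) a‖
        ≤ ∑ i, ‖c τ i * iteratedDeriv k (F (bumpτ τ i)) a‖ := norm_sum_le _ _
      _ ≤ ∑ i, ‖c τ i‖ * (Cs ^ k * ε) := by
          refine sum_le_sum fun i _ => ?_
          rw [norm_mul]
          exact mul_le_mul_of_nonneg_left (ih _ (by rw [tauNorm_bumpτ]; omega)) (norm_nonneg _)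
      _ = (∑ i, ‖c τ i‖) * (Cs ^ k * ε) := by rw [sum_mul]
      _ ≤ Cs * (Cs ^ k * ε) := mul_le_mul_of_nonneg_right (hc τ (by omega)) (by positivity)
      _ = Cs ^ (k + 1) * ε := by ring

/-! ### The twist factor `e^{γz}` (design B: a non-centred slab class) -/

/-- The iterated derivatives of `z ↦ e^{γz}`: `(e^{γz})^{(i)} = γⁱ e^{γz}`. [folklore] -/
private theorem iteratedDeriv_cexp_mul (γ : ℂ) (i : ℕ) (x : ℂ) :
    iteratedDeriv i (fun z => Complex.exp (γ * z)) x = γ ^ i * Complex.exp (γ * x) := by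
  induction i generalizing x with
  | zero => simp
  | succ i ih =>
    rw [iteratedDeriv_succ]
    have : iteratedDeriv i (fun z => Complex.exp (γ * z)) = fun z => γ ^ i * Complex.exp (γ * z) := funext ih
    rw [this]
    have hd : HasDerivAt (fun z => γ ^ i * Complex.exp (γ * z)) (γ ^ i * (Complex.exp (γ * x) * γ)) x := by
      have h1 : HasDerivAt (fun z => γ * z) γ x := by simpa using (hasDerivAt_id x).const_mul γ
      exact (h1.cexp).const_mul _
    rw [hd.deriv]; ring

/-- **Jets of a product, quantitative Leibniz rule**: `|u^{(i)}(x)| ≤ Cuⁱ·A`, `|g^{(i)}(x)| ≤ ε` for `i ≤ σ` ⇒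
`|(u·g)^{(σ)}(x)| ≤ (1+Cu)^σ·A·ε`. [folklore] -/
private theorem norm_iteratedDeriv_mul_le {u g : ℂ → ℂ} (hu : ContDiff ℂ ⊤ u) (hg : ContDiff ℂ ⊤ g)
    {x : ℂ} {σ : ℕ} {Cu A ε : ℝ} (hCu : 0 ≤ Cu) (hA : 0 ≤ A)
    (hub : ∀ i ≤ σ, ‖iteratedDeriv i u x‖ ≤ Cu ^ i * A) (hgb : ∀ i ≤ σ, ‖iteratedDeriv i g x‖ ≤ ε) :
    ‖iteratedDeriv σ (u * g) x‖ ≤ (1 + Cu) ^ σ * A * ε := by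
  rw [iteratedDeriv_mul (hu.contDiffAt.of_le le_top) (hg.contDiffAt.of_le le_top)]
  calc ‖∑ i ∈ range (σ + 1), (σ.choose i : ℂ) * iteratedDeriv i u x * iteratedDeriv (σ - i) g x‖
      ≤ ∑ i ∈ range (σ + 1), ‖(σ.choose i : ℂ) * iteratedDeriv i u x * iteratedDeriv (σ - i) g x‖ := norm_sum_le _ _
    _ ≤ ∑ i ∈ range (σ + 1), (σ.choose i : ℝ) * (Cu ^ i * A) * ε := by
        refine sum_le_sum fun i hi => ?_
        have hi' : i ≤ σ := Nat.lt_succ_iff.mp (mem_range.mp hi)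
        rw [norm_mul, norm_mul, Complex.norm_natCast]
        exact mul_le_mul (mul_le_mul_of_nonneg_left (hub i hi') (Nat.cast_nonneg _))
          (hgb (σ - i) (Nat.sub_le _ _)) (norm_nonneg _) (by positivity)
    _ = (∑ i ∈ range (σ + 1), (σ.choose i : ℝ) * Cu ^ i) * A * ε := by
        rw [sum_mul, sum_mul]; exact sum_congr rfl fun i _ => by ring
    _ = (1 + Cu) ^ σ * A * ε := by
        congr 2
        rw [show (1 : ℝ) + Cu = Cu + 1 from add_comm _ _, add_pow]
        exact sum_congr rfl fun i _ => by rw [one_pow, mul_one, mul_comm]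

/-- **The twisted jets**: for a family closed under `d/dz` as above, `‖F τ' (x)‖ ≤ ε` for `|τ'| ≤ M` and `|τ| + σ ≤ M` give
`‖(e^{γz} F τ)^{(σ)}(x)‖ ≤ ((1+‖γ‖)·Cs)^σ · e^{‖γ‖‖x‖} · ε` — the twist factor costs `‖γ‖‖x‖ + σ log(1+‖γ‖)` on the jets.
[folklore] (design-B twist; print's slab is centred, no twist: Nesterenko 2003 §4.2 (4.27), p. 88) -/
theorem norm_iteratedDeriv_twist_le (F : Tau n → ℂ → ℂ) (c : Tau n → Fin (n + 1) → ℂ)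
    (hdiff : ∀ τ, Differentiable ℂ (F τ)) (hode : ∀ τ z, deriv (F τ) z = ∑ i, c τ i * F (bumpτ τ i) z)
    {M : ℕ} {Cs : ℝ} (hCs1 : 1 ≤ Cs) (hc : ∀ τ, tauNorm τ < M → ∑ i, ‖c τ i‖ ≤ Cs)
    (γ x : ℂ) {ε : ℝ} (hε0 : 0 ≤ ε) (hε : ∀ τ : Tau n, tauNorm τ ≤ M → ‖F τ x‖ ≤ ε)
    {σ : ℕ} (τ : Tau n) (hτ : tauNorm τ + σ ≤ M) :
    ‖iteratedDeriv σ (fun z => Complex.exp (γ * z) * F τ z) x‖ ≤ ((1 + ‖γ‖) * Cs) ^ σ * Real.exp (‖γ‖ * ‖x‖) * ε := by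
  have hu : ContDiff ℂ ⊤ (fun z => Complex.exp (γ * z)) := by fun_prop
  have hjets := norm_iteratedDeriv_le_of_forall F c hdiff hode hCs1 hc x hε0 hε
  have hgb : ∀ i ≤ σ, ‖iteratedDeriv i (F τ) x‖ ≤ Cs ^ σ * ε := by
    intro i hi
    refine (hjets i τ (by omega)).trans ?_
    exact mul_le_mul_of_nonneg_right (pow_le_pow_right₀ hCs1 hi) hε0
  have hub : ∀ i ≤ σ, ‖iteratedDeriv i (fun z => Complex.exp (γ * z)) x‖ ≤ ‖γ‖ ^ i * Real.exp (‖γ‖ * ‖x‖) := by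
    intro i _
    rw [iteratedDeriv_cexp_mul, norm_mul, norm_pow, Complex.norm_exp]
    refine mul_le_mul_of_nonneg_left (Real.exp_le_exp.mpr ?_) (by positivity)
    calc (γ * x).re ≤ ‖γ * x‖ := Complex.re_le_norm _
      _ = ‖γ‖ * ‖x‖ := norm_mul _ _
  have key := norm_iteratedDeriv_mul_le hu ((hdiff τ).contDiff) (norm_nonneg γ) (Real.exp_pos _).le hub hgb
  have e : ((fun z => Complex.exp (γ * z)) * F τ) = fun z => Complex.exp (γ * z) * F τ z := rfl
  rw [e] at key
  calc ‖iteratedDeriv σ (fun z => Complex.exp (γ * z) * F τ z) x‖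
      ≤ (1 + ‖γ‖) ^ σ * Real.exp (‖γ‖ * ‖x‖) * (Cs ^ σ * ε) := key
    _ = ((1 + ‖γ‖) * Cs) ^ σ * Real.exp (‖γ‖ * ‖x‖) * ε := by rw [mul_pow]; ring

/-! ### The extrapolation at the symmetric nodes `|x| ≤ N` -/

/-- **The archimedean extrapolation bound at the symmetric nodes** (Nesterenko's `𝒳_{0,0}` and `𝒳_{s,ν}`, `ν ≥ 1`; the
archimedean twin of `G3Setup.norm_g3F_le_of_zerosΦ`).  Let `F : Tau n → ℂ → ℂ` be a family of entire functions closed under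
`d/dz` (`deriv (F τ) = Σᵢ c τ i · F (τ+eᵢ)`, `Σᵢ ‖c τ i‖ ≤ Cs`, `Cs ≥ 1` for `|τ| < Tlo`), `γ ∈ ℂ` a twist, `E ≥ 1` the free
radius ratio.  If `‖F τ'' (x)‖ ≤ ε` at all integers `|x| ≤ N` for all `|τ''| < Tlo` (approximate zeros) and
`‖e^{γz} F τ (z)‖ ≤ B_G` on the disc `‖z‖ ≤ (3E+1)(2N+1) + N`, then for `|τ| + t ≤ Tlo` (`t ≥ 1`) and `‖w‖ ≤ 3N + 2`:
`‖e^{γw} F τ (w)‖ ≤ 2(2N+1)^{t+1} t (20e)^{(2N+1)t} · ((1+‖γ‖)Cs)ᵗ e^{‖γ‖N} ε + B_G · (1/E)^{(2N+1)t}`.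
[cite: Nesterenko2003, §4.1 (4.8)–(4.11), Lemma 4.2, p. 81–83; §4.2 (4.24)–(4.32), p. 87–89] [cite: Waldschmidt1980, Lemma 3.5] -/
theorem norm_twist_le_of_small_values_symm (F : Tau n → ℂ → ℂ) (c : Tau n → Fin (n + 1) → ℂ)
    (hdiff : ∀ τ, Differentiable ℂ (F τ)) (hode : ∀ τ z, deriv (F τ) z = ∑ i, c τ i * F (bumpτ τ i) z)
    {Tlo : ℕ} {Cs : ℝ} (hCs1 : 1 ≤ Cs) (hc : ∀ τ, tauNorm τ < Tlo → ∑ i, ‖c τ i‖ ≤ Cs)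
    (γ : ℂ) (N : ℕ) {t : ℕ} (ht : 1 ≤ t) {ε BG E : ℝ} (hε0 : 0 ≤ ε) (hE : 1 ≤ E)
    (hsmall : ∀ x : ℤ, |x| ≤ (N : ℤ) → ∀ τ'' : Tau n, tauNorm τ'' < Tlo → ‖F τ'' (x : ℂ)‖ ≤ ε)
    (τ : Tau n) (hτ : tauNorm τ + t ≤ Tlo)
    (hBG : ∀ z : ℂ, ‖z‖ ≤ (3 * E + 1) * (2 * N + 1) + N → ‖Complex.exp (γ * z) * F τ z‖ ≤ BG)
    {w : ℂ} (hw : ‖w‖ ≤ 3 * N + 2) :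
    ‖Complex.exp (γ * w) * F τ w‖ ≤
      2 * ((2 * N + 1 : ℕ) : ℝ) ^ (t + 1) * t * (20 * Real.exp 1) ^ ((2 * N + 1) * t) *
          (((1 + ‖γ‖) * Cs) ^ t * Real.exp (‖γ‖ * N) * ε) +
        BG * (1 / E) ^ ((2 * N + 1) * t) := by
  set G : ℂ → ℂ := fun z => Complex.exp (γ * z) * F τ z with hG
  have hGd : Differentiable ℂ G := by
    have h1 : Differentiable ℂ (fun z : ℂ => Complex.exp (γ * z)) := by fun_prop
    exact h1.mul (hdiff τ)
  set εH : ℝ := ((1 + ‖γ‖) * Cs) ^ t * Real.exp (‖γ‖ * N) * ε with hεH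
  have hCs0 : 0 ≤ Cs := le_trans zero_le_one hCs1
  have h1γ : 1 ≤ (1 + ‖γ‖) * Cs := by nlinarith [norm_nonneg γ]
  have hεH0 : 0 ≤ εH := by positivity
  -- the jets at the nodes
  have hjet : ∀ j : ℤ, |j| ≤ (N : ℤ) → ∀ σ, σ < t → ‖iteratedDeriv σ G (j : ℂ)‖ ≤ εH := by
    intro j hj σ hσ
    have hval : ∀ τ' : Tau n, tauNorm τ' ≤ Tlo - 1 → ‖F τ' (j : ℂ)‖ ≤ ε :=
      fun τ' hτ' => hsmall j hj τ' (by omega)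
    have h := norm_iteratedDeriv_twist_le F c hdiff hode (M := Tlo - 1) hCs1 (fun τ' hτ' => hc τ' (by omega))
      γ (j : ℂ) hε0 hval (σ := σ) τ (by omega)
    refine h.trans ?_
    have hjn : ‖(j : ℂ)‖ ≤ N := by
      rw [Complex.norm_intCast]; exact_mod_cast hj
    calc ((1 + ‖γ‖) * Cs) ^ σ * Real.exp (‖γ‖ * ‖(j : ℂ)‖) * ε
        ≤ ((1 + ‖γ‖) * Cs) ^ t * Real.exp (‖γ‖ * N) * ε := by
          refine mul_le_mul_of_nonneg_right ?_ hε0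
          exact mul_le_mul (pow_le_pow_right₀ h1γ hσ.le)
            (Real.exp_le_exp.mpr (mul_le_mul_of_nonneg_left hjn (norm_nonneg _))) (Real.exp_pos _).le
            (by positivity)
      _ = εH := rfl
  exact hermite_symm_integer_points_ratio hGd N ht hεH0 hE hjet hBG hw

/-- **The untwisted value**: under the hypotheses of `norm_twist_le_of_small_values_symm`,
`‖F τ (w)‖ ≤ e^{‖γ‖‖w‖} · (2(2N+1)^{t+1} t (20e)^{(2N+1)t} ((1+‖γ‖)Cs)ᵗ e^{‖γ‖N} ε + B_G (1/E)^{(2N+1)t})` for `‖w‖ ≤ 3N+2`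
(the twist is paid once more at the new point). [cite: Nesterenko2003, §4.1 (4.8)–(4.11), Lemma 4.2; §4.2 (4.24)–(4.32), p. 81–89] -/
theorem norm_le_of_small_values_symm (F : Tau n → ℂ → ℂ) (c : Tau n → Fin (n + 1) → ℂ)
    (hdiff : ∀ τ, Differentiable ℂ (F τ)) (hode : ∀ τ z, deriv (F τ) z = ∑ i, c τ i * F (bumpτ τ i) z)
    {Tlo : ℕ} {Cs : ℝ} (hCs1 : 1 ≤ Cs) (hc : ∀ τ, tauNorm τ < Tlo → ∑ i, ‖c τ i‖ ≤ Cs)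
    (γ : ℂ) (N : ℕ) {t : ℕ} (ht : 1 ≤ t) {ε BG E : ℝ} (hε0 : 0 ≤ ε) (hE : 1 ≤ E)
    (hsmall : ∀ x : ℤ, |x| ≤ (N : ℤ) → ∀ τ'' : Tau n, tauNorm τ'' < Tlo → ‖F τ'' (x : ℂ)‖ ≤ ε)
    (τ : Tau n) (hτ : tauNorm τ + t ≤ Tlo)
    (hBG : ∀ z : ℂ, ‖z‖ ≤ (3 * E + 1) * (2 * N + 1) + N → ‖Complex.exp (γ * z) * F τ z‖ ≤ BG)
    {w : ℂ} (hw : ‖w‖ ≤ 3 * N + 2) :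
    ‖F τ w‖ ≤ Real.exp (‖γ‖ * ‖w‖) *
      (2 * ((2 * N + 1 : ℕ) : ℝ) ^ (t + 1) * t * (20 * Real.exp 1) ^ ((2 * N + 1) * t) *
          (((1 + ‖γ‖) * Cs) ^ t * Real.exp (‖γ‖ * N) * ε) +
        BG * (1 / E) ^ ((2 * N + 1) * t)) := by
  have h := norm_twist_le_of_small_values_symm F c hdiff hode hCs1 hc γ N ht hε0 hE hsmall τ hτ hBG hw
  have e : F τ w = Complex.exp (-(γ * w)) * (Complex.exp (γ * w) * F τ w) := by
    rw [← mul_assoc, ← Complex.exp_add, neg_add_cancel, Complex.exp_zero, one_mul]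
  rw [e, norm_mul]
  refine mul_le_mul ?_ h (norm_nonneg _) (Real.exp_pos _).le
  rw [Complex.norm_exp]
  refine Real.exp_le_exp.mpr ?_
  calc (-(γ * w)).re ≤ ‖-(γ * w)‖ := Complex.re_le_norm _
    _ = ‖γ‖ * ‖w‖ := by rw [norm_neg, norm_mul]

/-! ### The extrapolation at the odd nodes `x ≡ 1 (2)`, `|x| ≤ 2m − 1` -/

/-- **The archimedean extrapolation bound at the odd nodes** (Nesterenko's `𝒳_{s,0}`, `s ≥ 1`; the archimedean twin of
`G3Setup.norm_g3F_le_of_zerosΦ_oddNodes`): with `F`, `c`, `Cs`, `γ`, `E` as in `norm_twist_le_of_small_values_symm`, if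
`‖F τ'' (x)‖ ≤ ε` at all ODD integers `|x| ≤ 2m − 1` (`m ≥ 1`) for `|τ''| < Tlo` and `‖e^{γz} F τ (z)‖ ≤ B_G` on
`‖z‖ ≤ (12E+6)m`, then for `|τ| + t ≤ Tlo` and `‖w‖ ≤ 6m`:
`‖e^{γw} F τ (w)‖ ≤ 2(2m)^{t+1} t (20e)^{2mt} · 2ᵗ((1+‖γ‖)Cs)ᵗ e^{‖γ‖(2m−1)} ε + B_G (1/E)^{2mt}`.
[cite: Nesterenko2003, §4.1 (4.8)–(4.11), Lemma 4.2; §4.2 (4.24)–(4.32) with the nodes 𝒳_{s,0}, §4.3 (4.36), p. 81–90] [cite: Waldschmidt1980, Lemma 3.5] -/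
theorem norm_twist_le_of_small_values_odd (F : Tau n → ℂ → ℂ) (c : Tau n → Fin (n + 1) → ℂ)
    (hdiff : ∀ τ, Differentiable ℂ (F τ)) (hode : ∀ τ z, deriv (F τ) z = ∑ i, c τ i * F (bumpτ τ i) z)
    {Tlo : ℕ} {Cs : ℝ} (hCs1 : 1 ≤ Cs) (hc : ∀ τ, tauNorm τ < Tlo → ∑ i, ‖c τ i‖ ≤ Cs)
    (γ : ℂ) {m t : ℕ} (hm : 1 ≤ m) (ht : 1 ≤ t) {ε BG E : ℝ} (hε0 : 0 ≤ ε) (hE : 1 ≤ E)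
    (hsmall : ∀ x : ℤ, Odd x → |x| ≤ 2 * (m : ℤ) - 1 → ∀ τ'' : Tau n, tauNorm τ'' < Tlo → ‖F τ'' (x : ℂ)‖ ≤ ε)
    (τ : Tau n) (hτ : tauNorm τ + t ≤ Tlo)
    (hBG : ∀ z : ℂ, ‖z‖ ≤ (12 * E + 6) * m → ‖Complex.exp (γ * z) * F τ z‖ ≤ BG)
    {w : ℂ} (hw : ‖w‖ ≤ 6 * m) :
    ‖Complex.exp (γ * w) * F τ w‖ ≤
      2 * ((2 * m : ℕ) : ℝ) ^ (t + 1) * t * (20 * Real.exp 1) ^ ((2 * m) * t) *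
          (2 ^ t * (((1 + ‖γ‖) * Cs) ^ t * Real.exp (‖γ‖ * (2 * m - 1)) * ε)) +
        BG * (1 / E) ^ ((2 * m) * t) := by
  set G : ℂ → ℂ := fun z => Complex.exp (γ * z) * F τ z with hG
  have hGd : Differentiable ℂ G := by
    have h1 : Differentiable ℂ (fun z : ℂ => Complex.exp (γ * z)) := by fun_prop
    exact h1.mul (hdiff τ)
  set εH : ℝ := ((1 + ‖γ‖) * Cs) ^ t * Real.exp (‖γ‖ * (2 * m - 1)) * ε with hεH
  have hCs0 : 0 ≤ Cs := le_trans zero_le_one hCs1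
  have h1γ : 1 ≤ (1 + ‖γ‖) * Cs := by nlinarith [norm_nonneg γ]
  have hεH0 : 0 ≤ εH := by positivity
  have hjet : ∀ x : ℤ, Odd x → |x| ≤ 2 * (m : ℤ) - 1 → ∀ σ, σ < t → ‖iteratedDeriv σ G (x : ℂ)‖ ≤ εH := by
    intro x hxo hx' σ hσ
    have hval : ∀ τ' : Tau n, tauNorm τ' ≤ Tlo - 1 → ‖F τ' (x : ℂ)‖ ≤ ε :=
      fun τ' hτ' => hsmall x hxo hx' τ' (by omega)
    have h := norm_iteratedDeriv_twist_le F c hdiff hode (M := Tlo - 1) hCs1 (fun τ' hτ' => hc τ' (by omega))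
      γ (x : ℂ) hε0 hval (σ := σ) τ (by omega)
    refine h.trans ?_
    have hxn : ‖(x : ℂ)‖ ≤ 2 * m - 1 := by
      rw [Complex.norm_intCast]; exact_mod_cast hx'
    calc ((1 + ‖γ‖) * Cs) ^ σ * Real.exp (‖γ‖ * ‖(x : ℂ)‖) * ε
        ≤ ((1 + ‖γ‖) * Cs) ^ t * Real.exp (‖γ‖ * (2 * m - 1)) * ε := by
          refine mul_le_mul_of_nonneg_right ?_ hε0
          exact mul_le_mul (pow_le_pow_right₀ h1γ hσ.le)
            (Real.exp_le_exp.mpr (mul_le_mul_of_nonneg_left hxn (norm_nonneg _))) (Real.exp_pos _).le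
            (by positivity)
      _ = εH := rfl
  exact hermite_odd_points_ratio hGd hm ht hεH0 hE hjet hBG hw

/-- **The untwisted value at the odd-node step**: `‖F τ (w)‖ ≤ e^{‖γ‖‖w‖} · (…)` for `‖w‖ ≤ 6m`, under the hypotheses of
`norm_twist_le_of_small_values_odd`. [cite: Nesterenko2003, §4.2 Lemma 4.3 with the nodes 𝒳_{s,0}] -/
theorem norm_le_of_small_values_odd (F : Tau n → ℂ → ℂ) (c : Tau n → Fin (n + 1) → ℂ)
    (hdiff : ∀ τ, Differentiable ℂ (F τ)) (hode : ∀ τ z, deriv (F τ) z = ∑ i, c τ i * F (bumpτ τ i) z)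
    {Tlo : ℕ} {Cs : ℝ} (hCs1 : 1 ≤ Cs) (hc : ∀ τ, tauNorm τ < Tlo → ∑ i, ‖c τ i‖ ≤ Cs)
    (γ : ℂ) {m t : ℕ} (hm : 1 ≤ m) (ht : 1 ≤ t) {ε BG E : ℝ} (hε0 : 0 ≤ ε) (hE : 1 ≤ E)
    (hsmall : ∀ x : ℤ, Odd x → |x| ≤ 2 * (m : ℤ) - 1 → ∀ τ'' : Tau n, tauNorm τ'' < Tlo → ‖F τ'' (x : ℂ)‖ ≤ ε)
    (τ : Tau n) (hτ : tauNorm τ + t ≤ Tlo)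
    (hBG : ∀ z : ℂ, ‖z‖ ≤ (12 * E + 6) * m → ‖Complex.exp (γ * z) * F τ z‖ ≤ BG)
    {w : ℂ} (hw : ‖w‖ ≤ 6 * m) :
    ‖F τ w‖ ≤ Real.exp (‖γ‖ * ‖w‖) *
      (2 * ((2 * m : ℕ) : ℝ) ^ (t + 1) * t * (20 * Real.exp 1) ^ ((2 * m) * t) *
          (2 ^ t * (((1 + ‖γ‖) * Cs) ^ t * Real.exp (‖γ‖ * (2 * m - 1)) * ε)) +
        BG * (1 / E) ^ ((2 * m) * t)) := by
  have h := norm_twist_le_of_small_values_odd F c hdiff hode hCs1 hc γ hm ht hε0 hE hsmall τ hτ hBG hw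
  have e : F τ w = Complex.exp (-(γ * w)) * (Complex.exp (γ * w) * F τ w) := by
    rw [← mul_assoc, ← Complex.exp_add, neg_add_cancel, Complex.exp_zero, one_mul]
  rw [e, norm_mul]
  refine mul_le_mul ?_ h (norm_nonneg _) (Real.exp_pos _).le
  rw [Complex.norm_exp]
  refine Real.exp_le_exp.mpr ?_
  calc (-(γ * w)).re ≤ ‖-(γ * w)‖ := Complex.re_le_norm _
    _ = ‖γ‖ * ‖w‖ := by rw [norm_neg, norm_mul]

end ArchKStep

end Summit.ABC.StewartYu

end
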